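import Summits.Ventures.CertifiedManyBodySolver.Observables.StiffnessApexTransportRayStation
import Literature.MathematicalPhysics.QuantumLattice.TorusGroundStateParticleHole
import Literature.MathematicalPhysics.QuantumLattice.TorusLimitParticleHoleEnergyWords
import HarnessLib

/-!
# Ventures/CertifiedManyBodySolver — Observables/StiffnessApexTransportMottStation.lean

HONEST FRAMING: one-sided certified CEILINGS on the uniform flux stiffness (t–t′ f-sum class) at HALF FILLING (`n = 1`, the Mott CONTROL/CALIBRATION
line: `ρ_s = 0` there in print, which is NOT a theorem of the tree), transported to targets with `t′ ≠ 0` from a `t′ = 0` STATION `(0, U_A, 1)` whose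
certified word is a KINETIC ceiling `−k(ω) ≤ X` — WITHOUT any `K₂` price and for EITHER sign of `t′`; every leaf is CONDITIONAL on the rows / claim nodes
it names; a ceiling never speaks to the presence of order; not a `T_c` estimate, not a superconductivity verdict; no number of record. Zero compute, no
definition, no claim node, no `sorry`.

Cell `pub/hubbard-fast` (D-0154 (1)(A) «CERTIFICATE REUSE along parameter paths»), seat `hubbard-fast-reuse-2` g5 (`prover-hubbard-fast-reuse-2-g5-0`), path family
«APEX TRANSPORT», line «PH-SIGNED MOTT STATION». Companion of this seat's `Observables/StiffnessApexTransportWeightedBracket.lean` (g3),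
`…FermiSeaAnchor.lean` and `…RayStation.lean` (g4).

THE POINT. A `t′ = 0` station's word is a kinetic ceiling `−k ≤ X`, i.e. the floor `−X ≤ K₁ = e_{Φ(1,0,0)}` on the torus-limit ground-state class of
`(0, U_A, n)`; to serve as an apex-bracket member for a target `(t′_P ≠ 0, U_P > U_A)` it must floor `e_{Φ(1,κ,0)} = K₁ + κK₂` at the apex hopping
`κ = −U_A t′_P/(U_P − U_A) ≠ 0`, which needs the SIGN of `K₂` on the station class — the ray device (g4) pays the kinematic price `|κ|·1.6211390` for it.
AT HALF FILLING THE PRICE IS ZERO: the staggered particle–hole map `α` carries a torus-limit ground state `ω` of `H_L(1, 0, U_A)` at `n = 1` (even sides,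
complementary record sectors) to a torus-limit ground state `ω ∘ α` of `H_L(1, −0, U_A) = H_L(1, 0, U_A)` at `2 − 1 = 1` — the SAME class —
(`IsTorusLimitOf.particleHole_of_sectorGroundStates`) with `K₁(ω ∘ α) = K₁(ω)` and `K₂(ω ∘ α) = −K₂(ω)` (`…meanEnergy_kineticWord_particleHole`,
`…meanEnergy_diagHopWord_particleHole`). Hence for every `κ` there EXISTS a class member `ω⋆ ∈ {ω, ω ∘ α}` with `κ·K₂(ω⋆) ≥ 0`, so
`−X ≤ K₁(ω⋆) ≤ e_{Φ(1,κ,0)}(ω⋆)` (§1). The apex row needs ONE source state only (the masters of g3/g4 already PICK theirs by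
`exists_isTorusLimitOf_sectorGroundState_TT'`), so an EXISTENTIAL-source edition of the masters (§2) closes the bracket: with a kernel Fermi-sea row
`ℓ₂ ≤ e(1, κ₂, 0, 1)` on the other side of `2t′_P`, `ρ_s(P) ≤ μ_A·X/4 + μ₂·(−ℓ₂/4)`, `μ_Aκ + μ₂κ₂ = 2t′_P` (§3).

* §1 `exists_torusLimit_halfFilling_tp0_hoppingFloor_of_negKinetic_le` — the PH-signed witness at ANY hopping `κ`;
* §2 `ObsStiffnessSeqCeilingAt_of_apexSourceWitness_fermiSeaRow_weighted` (witness × free-gas floor) and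
  `ObsStiffnessSeqCeilingAt_of_apexSourceWitness_apexSource_weighted` (witness × a universal floor on a second source class) — any density;
* §3 half filling: `ObsStiffnessSeqCeilingAt_halfFilling_of_mottStation_fermiSeaRow_weighted` (Mott station × Fermi-sea row, either sign of `t′`) and
  `ObsStiffnessSeqCeilingAt_halfFilling_of_mottStation_fsumFloorSource_weighted` (Mott station × an own-word-and-`K₂`-floor source, e.g. a half-filling fan);
* §4 leaves with the natural weights: `ObsStiffnessSeqCeilingAt_halfFilling_mottStation_leftLeaf` (`t′ ≤ 0`, free member at `κ₂ < 2t′`) and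
  `…_rightLeaf` (`t′ ≥ 0`, free member at `κ₂ > 2t′`) — the caller supplies the target inequalities, the station ceiling, the free floor and one `norm_num`;
* rectangles (whole boxes from four corner checks — the cleared leaf inequality is bilinear in `(U, t′)`) live in the companion
  `Observables/StiffnessApexTransportMottStationRects.lean`.

NOT said: nothing flows toward `U_P ≤ U_A`; the sign trick is a HALF-FILLING fact (`n ≠ 1`: the twin class sits at density `2 − n`); `λ ≠ 0` words are not
of this form; no `T > 0`; `ρ_s = 0` on the Mott line is print, not a theorem here.

References: T. Koma, H. Tasaki, J. Stat. Phys. 76 (1994) 745, §1 [KomaTasaki1994]; D. J. Scalapino, S. R. White, S.-C. Zhang, PRB 47 (1993) 7995, §II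
[ScalapinoWhiteZhang1993]; E. H. Lieb, F. Y. Wu, Physica A 321 (2003) 1, §1 eq. (3) [LiebWuPhysicaA2003]; E. H. Lieb, PRL 62 (1989) 1201, Theorem 2
[LiebPRL1989]; E. H. Lieb, M. Loss, Duke Math. J. 71 (1993) 337, §8 Theorem 8.2 [LiebLoss1993]; O. Bratteli, D. W. Robinson, OAQSM II (1997), §6.2.4
[BratteliRobinsonII1997].
-/

noncomputable section

namespace Summit.Ventures.CertifiedManyBodySolver.Observables

open Literature.MathematicalPhysics.QuantumLattice
open Literature.MathematicalPhysics.QuantumLattice.ThermodynamicLimit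
open Literature.MathematicalPhysics.QuantumFieldTheory
open Literature.Probability.LatticeModels
open Matrix Finset Filter Topology HubbardWave0
open scoped Matrix BigOperators ComplexOrder

/-! ## §1 The particle–hole-signed witness on the half-filled `t′ = 0` station -/

section Witness

variable {U₀ : ℝ}

/-- **PH-SIGNED MOTT STATION (the witness).** If `−k(ω) ≤ X` (bond-form kinetic density) for every torus limit `ω` of unit `(rectN 1 L, S^z = 0)`-sector
ground states of `hubbardTorusTT' L 1 0 U₀`, then for EVERY hopping `κ` there is such a torus limit `ω⋆` (along sides `2·φ(j) → ∞`) with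
`−X ≤ e_{Φ(1,κ,0)}(ω⋆)`: take any torus-limit ground state `ω` along even sides; if `κ·K₂(ω) ≥ 0` then `ω⋆ = ω`
(`e_{Φ(1,κ,0)} = K₁ + κK₂ ≥ K₁ ≥ −X`), else `ω⋆ = ω ∘ α`, again a torus-limit ground state of the same class
(`IsTorusLimitOf.particleHole_of_sectorGroundStates` at `(1, 0, U₀, n = 1)`: `−0 = 0`, `2 − 1 = 1`, complementary sectors `2·(L²/2) = L²` on even `L`), with
`K₁(ω ∘ α) = K₁(ω)` and `K₂(ω ∘ α) = −K₂(ω)`. No `K₂` row, no sign hypothesis, no price.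
[cite: LiebWuPhysicaA2003, §1 eq. (3)] [cite: LiebPRL1989, Theorem 2 (bipartite lattice)] [cite: BratteliRobinsonII1997, §6.2.4] -/
theorem exists_torusLimit_halfFilling_tp0_hoppingFloor_of_negKinetic_le (κ : ℝ) {X : ℝ}
    (hX : ∀ (ω : InfVolFermionState 2) (Ls : ℕ → ℕ) (ψ : ∀ L, Fock (Orb (FermionTorus 2 L))),
      Tendsto Ls atTop atTop →
      (∀ j, IsGroundStateInSector (hubbardTorusTT' (Ls j) 1 0 U₀) (rectN 1 (Ls j)) 0 (ψ (Ls j))) →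
      (∀ j, star (ψ (Ls j)) ⬝ᵥ ψ (Ls j) = 1) → ω.IsTorusLimitOf ψ Ls →
      -(∑ i : Fin 2, -(1 : ℝ) * ∑ σ : Fin 2,
          ((ω.expect {0, 0 + unitVec i}
              ((cAt 0 (mem_insert_self _ _) σ)ᴴ * cAt (0 + unitVec i) (mem_insert_of_mem (mem_singleton_self _)) σ)).re +
            (ω.expect {0, 0 + unitVec i}
              ((cAt (0 + unitVec i) (mem_insert_of_mem (mem_singleton_self _)) σ)ᴴ * cAt 0 (mem_insert_self _ _) σ)).re)) ≤ X) :
    ∃ (ω : InfVolFermionState 2) (Ls : ℕ → ℕ) (ψ : ∀ L, Fock (Orb (FermionTorus 2 L))),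
      Tendsto Ls atTop atTop ∧
      (∀ j, IsGroundStateInSector (hubbardTorusTT' (Ls j) 1 0 U₀) (rectN 1 (Ls j)) 0 (ψ (Ls j))) ∧
      (∀ j, star (ψ (Ls j)) ⬝ᵥ ψ (Ls j) = 1) ∧ ω.IsTorusLimitOf ψ Ls ∧
      -X ≤ ω.meanEnergy (hubbardTTPrimeFermionInteraction 1 κ 0) 1 := by
  classical
  -- a torus-limit ground state along EVEN sides `2·φ(j)`
  have h2 : Tendsto (fun j : ℕ => 2 * j) atTop atTop :=
    tendsto_atTop_mono (fun j => Nat.le_mul_of_pos_left j (by norm_num)) tendsto_id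
  obtain ⟨ψ, φ, ω, hφ, hψ, hψ1, hω, -, -, -⟩ :=
    exists_isTorusLimitOf_sectorGroundState_TT' 1 0 U₀ (n := 1) zero_le_one one_le_two (Ls := fun j : ℕ => 2 * j) h2
  set Ls : ℕ → ℕ := (fun j : ℕ => 2 * j) ∘ φ with hLs_def
  have hLs : Tendsto Ls atTop atTop := h2.comp hφ.tendsto_atTop
  have hψL : ∀ j, IsGroundStateInSector (hubbardTorusTT' (Ls j) 1 0 U₀) (rectN 1 (Ls j)) 0 (ψ (Ls j)) := fun j => hψ _
  have h1L : ∀ j, star (ψ (Ls j)) ⬝ᵥ ψ (Ls j) = 1 := fun j => hψ1 _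
  have hN : ∀ j, IsNParticle (rectN 1 (Ls j)) (ψ (Ls j)) := fun j => ((mem_szSector_iff _ _ _).1 (hψL j).1).1
  -- the kinetic floor `−X ≤ K₁(ω)`
  have hK₁ : -X ≤ ω.meanEnergy (hubbardTTPrimeFermionInteraction 1 0 0) 1 := by
    have hk := hX ω Ls ψ hLs hψL h1L hω
    rw [← meanEnergy_hubbardTTPrime_oneBody_eq_kineticDensity hω.isTranslationInvariant] at hk
    linarith
  have eκ := ω.meanEnergy_hubbardTTPrime_eq_coords 1 κ 0
  by_cases hsgn : 0 ≤ κ * ω.meanEnergy (hubbardTTPrimeFermionInteraction 0 1 0) 1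
  · refine ⟨ω, Ls, ψ, hLs, hψL, h1L, hω, ?_⟩
    rw [eκ]
    linarith
  · -- the particle–hole twin: same class, `K₁` equal, `K₂` negated
    have heven : ∀ᶠ j in atTop, Even (Ls j) := Eventually.of_forall fun j => by
      simp only [hLs_def, Function.comp_apply]; exact even_two_mul _
    have hadd : ∀ᶠ j in atTop, halfRectN (2 - 1) (Ls j) + halfRectN 1 (Ls j) = Ls j ^ 2 :=
      Eventually.of_forall fun j => halfRectN_two_sub_add_of_eq (n := 1) one_le_two (m := 2 * φ j ^ 2) (by
        simp only [hLs_def, Function.comp_apply]; push_cast; ring)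
    obtain ⟨ψ', hψ', h1', hω'⟩ :=
      hω.particleHole_of_sectorGroundStates 1 0 U₀ (n := 1) zero_le_one one_le_two heven hadd hψL h1L
    have hK₁' := hω.meanEnergy_kineticWord_particleHole hLs hN h1L heven
    have hK₂' := hω.meanEnergy_diagHopWord_particleHole hLs hN h1L heven
    have eκ' := ω.particleHole.meanEnergy_hubbardTTPrime_eq_coords 1 κ 0
    refine ⟨ω.particleHole, Ls, ψ', hLs, fun j => ?_, fun j => h1' _, hω', ?_⟩
    · have h := hψ' (Ls j)
      rw [neg_zero, show (2 : ℝ) - 1 = 1 by norm_num] at h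
      exact h
    · rw [eκ', hK₁', hK₂']
      rw [not_le] at hsgn
      nlinarith

end Witness

/-! ## §2 Existential-source masters (any density): ONE source given by a witness -/

section Master

variable {t'P UP n s₁ U₁ s₂ U₂ : ℝ}

/-- **APEX × FERMI-SEA WEIGHTED BRACKET with a source WITNESS (any density).** Target `(t′_P, U_P)`, density `0 ≤ n < 2`; one source `(s₁, U₁)` with
`0 ≤ U₁ < U_P` and apex hopping `κ₁ = (U_P s₁ − U₁ t′_P)/(U_P − U₁)`; a second hopping `κ₂`; weights `μ₁, μ₂ ≥ 0`, `μ₁ + μ₂ = 1`, `μ₁κ₁ + μ₂κ₂ = 2t′_P`. If SOME torus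
limit `ω₁` of unit `(rectN n L, S^z = 0)`-sector ground states of `hubbardTorusTT' L 1 s₁ U₁` (along some `Ls → ∞`) has `ℓ₁ ≤ e_{Φ(1,κ₁,0)}(ω₁)`, and `ℓ₂ ≤ e(1, κ₂, 0, n)`,
then `ObsStiffnessSeqCeilingAt t′_P U_P n c` for every rational `c ≥ −(μ₁ℓ₁ + μ₂ℓ₂)/4` — the proof of `ObsStiffnessSeqCeilingAt_of_apexSource_fermiSeaRow_weighted`
verbatim with the witness in place of `exists_isTorusLimitOf_sectorGroundState_TT'` (the apex row `IsTorusLimitOf.meanEnergy_apexHopping_le_of_groundStates` compares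
ONE source state with the target state). [cite: KomaTasaki1994, §1] [cite: ScalapinoWhiteZhang1993, §II] [cite: LiebLoss1993, §8, Theorem 8.2] -/
theorem ObsStiffnessSeqCeilingAt_of_apexSourceWitness_fermiSeaRow_weighted (hU₁0 : 0 ≤ U₁) (hU₁ : U₁ < UP)
    (hn0 : 0 ≤ n) (hn2 : n < 2) {μ₁ μ₂ : ℝ} (hμ₁ : 0 ≤ μ₁) (hμ₂ : 0 ≤ μ₂) (hμ : μ₁ + μ₂ = 1) (κ₂ : ℝ)
    (hκ : μ₁ * ((UP * s₁ - U₁ * t'P) / (UP - U₁)) + μ₂ * κ₂ = 2 * t'P) {ℓ₁ ℓ₂ : ℝ}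
    (h₁ : ∃ (ω : InfVolFermionState 2) (Ls : ℕ → ℕ) (ψ : ∀ L, Fock (Orb (FermionTorus 2 L))),
      Tendsto Ls atTop atTop ∧
      (∀ j, IsGroundStateInSector (hubbardTorusTT' (Ls j) 1 s₁ U₁) (rectN n (Ls j)) 0 (ψ (Ls j))) ∧
      (∀ j, star (ψ (Ls j)) ⬝ᵥ ψ (Ls j) = 1) ∧ ω.IsTorusLimitOf ψ Ls ∧
      ℓ₁ ≤ ω.meanEnergy (hubbardTTPrimeFermionInteraction 1 ((UP * s₁ - U₁ * t'P) / (UP - U₁)) 0) 1)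
    (h₂ : ℓ₂ ≤ energyDensityTT' 1 κ₂ 0 n)
    (c : ℚ) (hc : -(μ₁ * ℓ₁ + μ₂ * ℓ₂) / 4 ≤ ((c : ℚ) : ℝ)) :
    ObsStiffnessSeqCeilingAt t'P UP n c := by
  intro ρs θ₀ _ hθ₀ Ls hLs hst
  refine fluxStiffness_le_of_torusLimitTT'_oddMoment_orbit_certificate_seq t'P (U := UP) (δ := 1 - n) (q := ((c : ℚ) : ℝ)) 0
    Finset.univ Finset.univ_nonempty (by linarith) (by linarith) hθ₀ hLs hst ?_
  intro ω Ms ψ hMs hψ h1 hω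
  have hψ' : ∀ j, IsGroundStateInSector (hubbardTorusTT' (Ms j) 1 t'P UP) (rectN n (Ms j)) 0 (ψ (Ms j)) := fun j => by
    simpa only [sub_sub_cancel] using hψ j
  have hN : ∀ j, IsNParticle (rectN n (Ms j)) (ψ (Ms j)) := fun j => ((mem_szSector_iff _ _ _).1 (hψ' j).1).1
  rw [orbitMean_rotOddMomentLimitFunctionalTT_lam_zero_eq_meanEnergy_twice_tPrime hω.isTranslationInvariant]
  obtain ⟨ω₁, L₁, φ₁, hL₁, hφ₁, hφ₁1, hω₁, hl₁⟩ := h₁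
  -- the apex row, source witness → target, at the hopping `κ₁`
  have hapx₁ := InfVolFermionState.IsTorusLimitOf.meanEnergy_apexHopping_le_of_groundStates 1 s₁ t'P hU₁0 hU₁ hn0 hn2
    hω₁ hL₁ hφ₁ hφ₁1 hω hMs hψ' h1
  -- the Fermi-sea row, read on the TARGET state
  have hfs := hω.energyDensityTT'_le_meanEnergy_hubbardTTPrime 1 κ₂ (U := 0) le_rfl hn0 hn2 hMs hN h1
  -- the one-body functional of the TARGET state is affine in the hopping
  set κ₁ : ℝ := (UP * s₁ - U₁ * t'P) / (UP - U₁) with hκ₁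
  have e₁ := ω.meanEnergy_hubbardTTPrime_eq_coords 1 κ₁ 0
  have e₂ := ω.meanEnergy_hubbardTTPrime_eq_coords 1 κ₂ 0
  have eP := ω.meanEnergy_hubbardTTPrime_eq_coords 1 (2 * t'P) 0
  have haff : ω.meanEnergy (hubbardTTPrimeFermionInteraction 1 (2 * t'P) 0) 1 =
      μ₁ * ω.meanEnergy (hubbardTTPrimeFermionInteraction 1 κ₁ 0) 1 +
        μ₂ * ω.meanEnergy (hubbardTTPrimeFermionInteraction 1 κ₂ 0) 1 := by
    rw [e₁, e₂, eP, ← hκ]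
    linear_combination (ω.meanEnergy (hubbardTTPrimeFermionInteraction 1 0 0) 1) * hμ.symm
  have hw₁ := mul_le_mul_of_nonneg_left (hl₁.trans hapx₁) hμ₁
  have hw₂ := mul_le_mul_of_nonneg_left (h₂.trans hfs) hμ₂
  have hc' : -(μ₁ * ℓ₁ + μ₂ * ℓ₂) / 4 ≤ ((c : ℚ) : ℝ) := hc
  rw [haff]
  linarith

/-- **TWO-SOURCE WEIGHTED BRACKET with a WITNESS for source 1 (any density).** Source 1 `(s₁, U₁)` as above, given by a witness `ω₁` with
`ℓ₁ ≤ e_{Φ(1,κ₁,0)}(ω₁)`; source 2 `(s₂, U₂)`, `0 ≤ U₂ < U_P`, with a floor `ℓ₂ ≤ e_{Φ(1,κ₂,0)}` on its WHOLE class, `κ₂ = (U_P s₂ − U₂ t′_P)/(U_P − U₂)`;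
`μ₁κ₁ + μ₂κ₂ = 2t′_P`. Then `ObsStiffnessSeqCeilingAt t′_P U_P n c` for every rational `c ≥ −(μ₁ℓ₁ + μ₂ℓ₂)/4` (g3's master
`ObsStiffnessSeqCeilingAt_of_two_apexSources_weighted` with the witness in place of the first existence call). [cite: KomaTasaki1994, §1] [cite: ScalapinoWhiteZhang1993, §II] -/
theorem ObsStiffnessSeqCeilingAt_of_apexSourceWitness_apexSource_weighted (hU₁0 : 0 ≤ U₁) (hU₁ : U₁ < UP) (hU₂0 : 0 ≤ U₂) (hU₂ : U₂ < UP)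
    (hn0 : 0 ≤ n) (hn2 : n < 2) {μ₁ μ₂ : ℝ} (hμ₁ : 0 ≤ μ₁) (hμ₂ : 0 ≤ μ₂) (hμ : μ₁ + μ₂ = 1)
    (hκ : μ₁ * ((UP * s₁ - U₁ * t'P) / (UP - U₁)) + μ₂ * ((UP * s₂ - U₂ * t'P) / (UP - U₂)) = 2 * t'P) {ℓ₁ ℓ₂ : ℝ}
    (h₁ : ∃ (ω : InfVolFermionState 2) (Ls : ℕ → ℕ) (ψ : ∀ L, Fock (Orb (FermionTorus 2 L))),
      Tendsto Ls atTop atTop ∧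
      (∀ j, IsGroundStateInSector (hubbardTorusTT' (Ls j) 1 s₁ U₁) (rectN n (Ls j)) 0 (ψ (Ls j))) ∧
      (∀ j, star (ψ (Ls j)) ⬝ᵥ ψ (Ls j) = 1) ∧ ω.IsTorusLimitOf ψ Ls ∧
      ℓ₁ ≤ ω.meanEnergy (hubbardTTPrimeFermionInteraction 1 ((UP * s₁ - U₁ * t'P) / (UP - U₁)) 0) 1)
    (h₂ : ∀ (ω : InfVolFermionState 2) (Ls : ℕ → ℕ) (ψ : ∀ L, Fock (Orb (FermionTorus 2 L))),
      Tendsto Ls atTop atTop →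
      (∀ j, IsGroundStateInSector (hubbardTorusTT' (Ls j) 1 s₂ U₂) (rectN n (Ls j)) 0 (ψ (Ls j))) →
      (∀ j, star (ψ (Ls j)) ⬝ᵥ ψ (Ls j) = 1) → ω.IsTorusLimitOf ψ Ls →
      ℓ₂ ≤ ω.meanEnergy (hubbardTTPrimeFermionInteraction 1 ((UP * s₂ - U₂ * t'P) / (UP - U₂)) 0) 1)
    (c : ℚ) (hc : -(μ₁ * ℓ₁ + μ₂ * ℓ₂) / 4 ≤ ((c : ℚ) : ℝ)) :
    ObsStiffnessSeqCeilingAt t'P UP n c := by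
  intro ρs θ₀ _ hθ₀ Ls hLs hst
  refine fluxStiffness_le_of_torusLimitTT'_oddMoment_orbit_certificate_seq t'P (U := UP) (δ := 1 - n) (q := ((c : ℚ) : ℝ)) 0
    Finset.univ Finset.univ_nonempty (by linarith) (by linarith) hθ₀ hLs hst ?_
  intro ω Ms ψ hMs hψ h1 hω
  have hψ' : ∀ j, IsGroundStateInSector (hubbardTorusTT' (Ms j) 1 t'P UP) (rectN n (Ms j)) 0 (ψ (Ms j)) := fun j => by
    simpa only [sub_sub_cancel] using hψ j
  rw [orbitMean_rotOddMomentLimitFunctionalTT_lam_zero_eq_meanEnergy_twice_tPrime hω.isTranslationInvariant]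
  obtain ⟨ω₁, L₁, φ₁, hL₁, hφ₁, hφ₁1, hω₁, hl₁⟩ := h₁
  obtain ⟨φ₂, g₂, ω₂, hg₂, hφ₂, hφ₂1, hω₂, -, -, -⟩ :=
    exists_isTorusLimitOf_sectorGroundState_TT' 1 s₂ U₂ hn0 hn2.le (Ls := id) tendsto_id
  have hL₂ : Tendsto (id ∘ g₂ : ℕ → ℕ) atTop atTop := tendsto_id.comp hg₂.tendsto_atTop
  have hapx₁ := InfVolFermionState.IsTorusLimitOf.meanEnergy_apexHopping_le_of_groundStates 1 s₁ t'P hU₁0 hU₁ hn0 hn2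
    hω₁ hL₁ hφ₁ hφ₁1 hω hMs hψ' h1
  have hapx₂ := InfVolFermionState.IsTorusLimitOf.meanEnergy_apexHopping_le_of_groundStates 1 s₂ t'P hU₂0 hU₂ hn0 hn2
    hω₂ hL₂ (fun j => hφ₂ _) (fun j => hφ₂1 _) hω hMs hψ' h1
  have hl₂ := h₂ ω₂ (id ∘ g₂) φ₂ hL₂ (fun j => hφ₂ _) (fun j => hφ₂1 _) hω₂
  set κ₁ : ℝ := (UP * s₁ - U₁ * t'P) / (UP - U₁) with hκ₁
  set κ₂ : ℝ := (UP * s₂ - U₂ * t'P) / (UP - U₂) with hκ₂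
  have e₁ := ω.meanEnergy_hubbardTTPrime_eq_coords 1 κ₁ 0
  have e₂ := ω.meanEnergy_hubbardTTPrime_eq_coords 1 κ₂ 0
  have eP := ω.meanEnergy_hubbardTTPrime_eq_coords 1 (2 * t'P) 0
  have haff : ω.meanEnergy (hubbardTTPrimeFermionInteraction 1 (2 * t'P) 0) 1 =
      μ₁ * ω.meanEnergy (hubbardTTPrimeFermionInteraction 1 κ₁ 0) 1 +
        μ₂ * ω.meanEnergy (hubbardTTPrimeFermionInteraction 1 κ₂ 0) 1 := by
    rw [e₁, e₂, eP, ← hκ]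
    linear_combination (ω.meanEnergy (hubbardTTPrimeFermionInteraction 1 0 0) 1) * hμ.symm
  have hw₁ := mul_le_mul_of_nonneg_left (hl₁.trans hapx₁) hμ₁
  have hw₂ := mul_le_mul_of_nonneg_left (hl₂.trans hapx₂) hμ₂
  have hc' : -(μ₁ * ℓ₁ + μ₂ * ℓ₂) / 4 ≤ ((c : ℚ) : ℝ) := hc
  rw [haff]
  linarith

end Master

/-! ## §3 Half filling: the Mott station as a bracket member, either sign of `t′`, no `K₂` price -/

section HalfFilling

variable {t'P UP U₀ s₂ U₂ : ℝ}

/-- **«Mott station × Fermi-sea row» (n = 1).** Station `(0, U₀)`, `0 ≤ U₀ < U_P`, with kinetic ceiling `−k ≤ X` on its torus-limit ground-state class at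
half filling; apex hopping of the line target → station `κ₁ = (U_P·0 − U₀t′_P)/(U_P − U₀)` (ANY sign); a free-gas floor `ℓ₂ ≤ e(1, κ₂, 0, 1)` at a hopping `κ₂` on the
other side of `2t′_P`; weights `μ₁, μ₂ ≥ 0`, `μ₁ + μ₂ = 1`, `μ₁κ₁ + μ₂κ₂ = 2t′_P`. Then `ObsStiffnessSeqCeilingAt t′_P U_P 1 c` for every rational
`c ≥ μ₁·X/4 + μ₂·(−ℓ₂/4)` — the §1 witness fed to the §2 master. [cite: KomaTasaki1994, §1] [cite: LiebWuPhysicaA2003, §1 eq. (3)] [cite: LiebLoss1993, §8, Theorem 8.2] -/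
theorem ObsStiffnessSeqCeilingAt_halfFilling_of_mottStation_fermiSeaRow_weighted (hU₀0 : 0 ≤ U₀) (hU₀ : U₀ < UP)
    {μ₁ μ₂ : ℝ} (hμ₁ : 0 ≤ μ₁) (hμ₂ : 0 ≤ μ₂) (hμ : μ₁ + μ₂ = 1) (κ₂ : ℝ)
    (hκ : μ₁ * ((UP * 0 - U₀ * t'P) / (UP - U₀)) + μ₂ * κ₂ = 2 * t'P) {X ℓ₂ : ℝ}
    (hX : ∀ (ω : InfVolFermionState 2) (Ls : ℕ → ℕ) (ψ : ∀ L, Fock (Orb (FermionTorus 2 L))),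
      Tendsto Ls atTop atTop →
      (∀ j, IsGroundStateInSector (hubbardTorusTT' (Ls j) 1 0 U₀) (rectN 1 (Ls j)) 0 (ψ (Ls j))) →
      (∀ j, star (ψ (Ls j)) ⬝ᵥ ψ (Ls j) = 1) → ω.IsTorusLimitOf ψ Ls →
      -(∑ i : Fin 2, -(1 : ℝ) * ∑ σ : Fin 2,
          ((ω.expect {0, 0 + unitVec i}
              ((cAt 0 (mem_insert_self _ _) σ)ᴴ * cAt (0 + unitVec i) (mem_insert_of_mem (mem_singleton_self _)) σ)).re +
            (ω.expect {0, 0 + unitVec i}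
              ((cAt (0 + unitVec i) (mem_insert_of_mem (mem_singleton_self _)) σ)ᴴ * cAt 0 (mem_insert_self _ _) σ)).re)) ≤ X)
    (h₂ : ℓ₂ ≤ energyDensityTT' 1 κ₂ 0 1)
    (c : ℚ) (hc : μ₁ * (X / 4) + μ₂ * (-ℓ₂ / 4) ≤ ((c : ℚ) : ℝ)) :
    ObsStiffnessSeqCeilingAt t'P UP 1 c :=
  ObsStiffnessSeqCeilingAt_of_apexSourceWitness_fermiSeaRow_weighted (s₁ := 0) (n := 1) hU₀0 hU₀ zero_le_one one_lt_two hμ₁ hμ₂ hμ κ₂ hκ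
    (exists_torusLimit_halfFilling_tp0_hoppingFloor_of_negKinetic_le ((UP * 0 - U₀ * t'P) / (UP - U₀)) hX) h₂ c (by
      have e : -(μ₁ * (-X) + μ₂ * ℓ₂) / 4 = μ₁ * (X / 4) + μ₂ * (-ℓ₂ / 4) := by ring
      rw [e]; exact hc)

/-- **«Mott station × own-word-and-floor source» (n = 1).** Station `(0, U₀)` as above (witness member, any sign of `κ₁`); second member = a class `(s₂, U₂, 1)`,
`0 ≤ U₂ < U_P`, carrying its OWN f-sum orbit-lower family `v₂` at the slot `s₂` plus a floor `B₂ ≤ K₂` (at half filling with `s₂ ≤ 0` the tree has `0 ≤ K₂`, i.e. `B₂ = 0`: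
the price-free fan), orientation `2s₂ ≤ κ₂ = (U_P s₂ − U₂ t′_P)/(U_P − U₂)`; `μ₁κ₁ + μ₂κ₂ = 2t′_P`. Then `ObsStiffnessSeqCeilingAt t′_P U_P 1 c` for every
`c ≥ μ₁·X/4 + μ₂(−v₂ − (κ₂ − 2s₂)B₂/4)`. [cite: KomaTasaki1994, §1] [cite: ScalapinoWhiteZhang1993, §II] [cite: LiebWuPhysicaA2003, §1 eq. (3)] -/
theorem ObsStiffnessSeqCeilingAt_halfFilling_of_mottStation_fsumFloorSource_weighted (Uo₂ : ℝ) (hU₀0 : 0 ≤ U₀) (hU₀ : U₀ < UP)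
    (hU₂0 : 0 ≤ U₂) (hU₂ : U₂ < UP) {μ₁ μ₂ : ℝ} (hμ₁ : 0 ≤ μ₁) (hμ₂ : 0 ≤ μ₂) (hμ : μ₁ + μ₂ = 1)
    (hκ : μ₁ * ((UP * 0 - U₀ * t'P) / (UP - U₀)) + μ₂ * ((UP * s₂ - U₂ * t'P) / (UP - U₂)) = 2 * t'P)
    (h2s₂ : 2 * s₂ ≤ (UP * s₂ - U₂ * t'P) / (UP - U₂)) {X v₂ B₂ : ℝ}
    (hX : ∀ (ω : InfVolFermionState 2) (Ls : ℕ → ℕ) (ψ : ∀ L, Fock (Orb (FermionTorus 2 L))),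
      Tendsto Ls atTop atTop →
      (∀ j, IsGroundStateInSector (hubbardTorusTT' (Ls j) 1 0 U₀) (rectN 1 (Ls j)) 0 (ψ (Ls j))) →
      (∀ j, star (ψ (Ls j)) ⬝ᵥ ψ (Ls j) = 1) → ω.IsTorusLimitOf ψ Ls →
      -(∑ i : Fin 2, -(1 : ℝ) * ∑ σ : Fin 2,
          ((ω.expect {0, 0 + unitVec i}
              ((cAt 0 (mem_insert_self _ _) σ)ᴴ * cAt (0 + unitVec i) (mem_insert_of_mem (mem_singleton_self _)) σ)).re +
            (ω.expect {0, 0 + unitVec i}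
              ((cAt (0 + unitVec i) (mem_insert_of_mem (mem_singleton_self _)) σ)ᴴ * cAt 0 (mem_insert_self _ _) σ)).re)) ≤ X)
    (h₂ : ∀ (ω : InfVolFermionState 2) (Ls : ℕ → ℕ) (ψ : ∀ L, Fock (Orb (FermionTorus 2 L))),
      Tendsto Ls atTop atTop →
      (∀ j, IsGroundStateInSector (hubbardTorusTT' (Ls j) 1 s₂ U₂) (rectN 1 (Ls j)) 0 (ψ (Ls j))) →
      (∀ j, star (ψ (Ls j)) ⬝ᵥ ψ (Ls j) = 1) → ω.IsTorusLimitOf ψ Ls →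
      v₂ ≤ ((Finset.univ : Finset (DihedralGroup 4)).card : ℝ)⁻¹ * ∑ g ∈ (Finset.univ : Finset (DihedralGroup 4)),
        (ω.expect (d4ShiftSet g 0 (box 2 7)) (fermionEmbed (PolySite.d4Emb g 0 (box 2 7)) (-oddMomentObsTT s₂ Uo₂ 0))).re)
    (hB₂ : ∀ (ω : InfVolFermionState 2) (Ls : ℕ → ℕ) (ψ : ∀ L, Fock (Orb (FermionTorus 2 L))),
      Tendsto Ls atTop atTop →
      (∀ j, IsGroundStateInSector (hubbardTorusTT' (Ls j) 1 s₂ U₂) (rectN 1 (Ls j)) 0 (ψ (Ls j))) →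
      (∀ j, star (ψ (Ls j)) ⬝ᵥ ψ (Ls j) = 1) → ω.IsTorusLimitOf ψ Ls →
      B₂ ≤ ω.meanEnergy (hubbardTTPrimeFermionInteraction 0 1 0) 1)
    (c : ℚ) (hc : μ₁ * (X / 4) + μ₂ * (-v₂ - ((UP * s₂ - U₂ * t'P) / (UP - U₂) - 2 * s₂) * B₂ / 4) ≤ ((c : ℚ) : ℝ)) :
    ObsStiffnessSeqCeilingAt t'P UP 1 c :=
  ObsStiffnessSeqCeilingAt_of_apexSourceWitness_apexSource_weighted (s₁ := 0) (n := 1) hU₀0 hU₀ hU₂0 hU₂ zero_le_one one_lt_two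
    hμ₁ hμ₂ hμ hκ
    (exists_torusLimit_halfFilling_tp0_hoppingFloor_of_negKinetic_le ((UP * 0 - U₀ * t'P) / (UP - U₀)) hX)
    (hoppingFloor_of_ownSlot_orbitLower_of_le_diagHop Uo₂ v₂ h2s₂ h₂ hB₂) c (by
      have e : -(μ₁ * (-X) + μ₂ * (4 * v₂ + ((UP * s₂ - U₂ * t'P) / (UP - U₂) - 2 * s₂) * B₂)) / 4 =
          μ₁ * (X / 4) + μ₂ * (-v₂ - ((UP * s₂ - U₂ * t'P) / (UP - U₂) - 2 * s₂) * B₂ / 4) := by ring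
      rw [e]; exact hc)

end HalfFilling

/-! ## §4 Leaves with the natural weights (the caller supplies only the target inequalities, the station ceiling and the free floor) -/

section Leaves

variable {U₀ X UP t'P κ₂ ℓ₂ : ℝ}

/-- **MOTT-STATION LEAF, `t′ ≤ 0` (Fermi-sea member on the LEFT).** Station `(0, U₀)` with kinetic ceiling `−k ≤ X` on its half-filled class, `0 ≤ U₀ < U_P`, `t′_P ≤ 0`;
a free-gas floor `ℓ₂ ≤ e(1, κ₂, 0, 1)` at `κ₂ < 2t′_P`; the station's apex hopping `κ_A = −U₀t′_P/(U_P − U₀) ≥ 2t′_P` and the natural weights `μ_A = (2t′_P − κ₂)/(κ_A − κ₂)`,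
`μ₂ = (κ_A − 2t′_P)/(κ_A − κ₂)` (`anchor_weights_left`); `c ≥ μ_A·X/4 + μ₂·(−ℓ₂/4)` (written out) gives `ObsStiffnessSeqCeilingAt t′_P U_P 1 c`.
[cite: KomaTasaki1994, §1] [cite: LiebWuPhysicaA2003, §1 eq. (3)] [cite: LiebLoss1993, §8, Theorem 8.2] -/
theorem ObsStiffnessSeqCeilingAt_halfFilling_mottStation_leftLeaf (hU₀ : 0 ≤ U₀)
    (hX : ∀ (ω : InfVolFermionState 2) (Ls : ℕ → ℕ) (ψ : ∀ L, Fock (Orb (FermionTorus 2 L))),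
      Tendsto Ls atTop atTop →
      (∀ j, IsGroundStateInSector (hubbardTorusTT' (Ls j) 1 0 U₀) (rectN 1 (Ls j)) 0 (ψ (Ls j))) →
      (∀ j, star (ψ (Ls j)) ⬝ᵥ ψ (Ls j) = 1) → ω.IsTorusLimitOf ψ Ls →
      -(∑ i : Fin 2, -(1 : ℝ) * ∑ σ : Fin 2,
          ((ω.expect {0, 0 + unitVec i}
              ((cAt 0 (mem_insert_self _ _) σ)ᴴ * cAt (0 + unitVec i) (mem_insert_of_mem (mem_singleton_self _)) σ)).re +
            (ω.expect {0, 0 + unitVec i}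
              ((cAt (0 + unitVec i) (mem_insert_of_mem (mem_singleton_self _)) σ)ᴴ * cAt 0 (mem_insert_self _ _) σ)).re)) ≤ X)
    (hU : U₀ < UP) (ht : t'P ≤ 0) (hκ₂ : κ₂ < 2 * t'P) (h₂ : ℓ₂ ≤ energyDensityTT' 1 κ₂ 0 1) (c : ℚ)
    (hc : (2 * t'P - κ₂) / ((UP * 0 - U₀ * t'P) / (UP - U₀) - κ₂) * (X / 4) +
      ((UP * 0 - U₀ * t'P) / (UP - U₀) - 2 * t'P) / ((UP * 0 - U₀ * t'P) / (UP - U₀) - κ₂) * (-ℓ₂ / 4) ≤ ((c : ℚ) : ℝ)) :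
    ObsStiffnessSeqCeilingAt t'P UP 1 c := by
  have hd : 0 < UP - U₀ := by linarith
  have hR : 2 * t'P ≤ (UP * 0 - U₀ * t'P) / (UP - U₀) := by
    rw [le_div_iff₀ hd]; nlinarith [mul_nonneg_of_nonpos_of_nonpos ht (by linarith : -(2 * UP - U₀) ≤ 0)]
  have hlt : κ₂ < (UP * 0 - U₀ * t'P) / (UP - U₀) := lt_of_lt_of_le hκ₂ hR
  obtain ⟨hμ₁, hμ₂, hsum, hcomb⟩ := anchor_weights_left hlt hκ₂.le hR
  exact ObsStiffnessSeqCeilingAt_halfFilling_of_mottStation_fermiSeaRow_weighted hU₀ hU hμ₁ hμ₂ hsum κ₂ hcomb hX h₂ c hc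

/-- **MOTT-STATION LEAF, `t′ ≥ 0` (Fermi-sea member on the RIGHT).** As above with `0 ≤ t′_P`, a free-gas floor at `κ₂ > 2t′_P`, the station's apex hopping
`κ_A = −U₀t′_P/(U_P − U₀) ≤ 2t′_P` and the weights `μ_A = (κ₂ − 2t′_P)/(κ₂ − κ_A)`, `μ₂ = (2t′_P − κ_A)/(κ₂ − κ_A)` (`bracket_weights`); `c ≥ μ_A·X/4 + μ₂·(−ℓ₂/4)`.
No mirror, no even-sides caveat at the target. [cite: KomaTasaki1994, §1] [cite: LiebWuPhysicaA2003, §1 eq. (3)] [cite: LiebLoss1993, §8, Theorem 8.2] -/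
theorem ObsStiffnessSeqCeilingAt_halfFilling_mottStation_rightLeaf (hU₀ : 0 ≤ U₀)
    (hX : ∀ (ω : InfVolFermionState 2) (Ls : ℕ → ℕ) (ψ : ∀ L, Fock (Orb (FermionTorus 2 L))),
      Tendsto Ls atTop atTop →
      (∀ j, IsGroundStateInSector (hubbardTorusTT' (Ls j) 1 0 U₀) (rectN 1 (Ls j)) 0 (ψ (Ls j))) →
      (∀ j, star (ψ (Ls j)) ⬝ᵥ ψ (Ls j) = 1) → ω.IsTorusLimitOf ψ Ls →
      -(∑ i : Fin 2, -(1 : ℝ) * ∑ σ : Fin 2,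
          ((ω.expect {0, 0 + unitVec i}
              ((cAt 0 (mem_insert_self _ _) σ)ᴴ * cAt (0 + unitVec i) (mem_insert_of_mem (mem_singleton_self _)) σ)).re +
            (ω.expect {0, 0 + unitVec i}
              ((cAt (0 + unitVec i) (mem_insert_of_mem (mem_singleton_self _)) σ)ᴴ * cAt 0 (mem_insert_self _ _) σ)).re)) ≤ X)
    (hU : U₀ < UP) (ht : 0 ≤ t'P) (hκ₂ : 2 * t'P < κ₂) (h₂ : ℓ₂ ≤ energyDensityTT' 1 κ₂ 0 1) (c : ℚ)
    (hc : (κ₂ - 2 * t'P) / (κ₂ - (UP * 0 - U₀ * t'P) / (UP - U₀)) * (X / 4) +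
      (2 * t'P - (UP * 0 - U₀ * t'P) / (UP - U₀)) / (κ₂ - (UP * 0 - U₀ * t'P) / (UP - U₀)) * (-ℓ₂ / 4) ≤ ((c : ℚ) : ℝ)) :
    ObsStiffnessSeqCeilingAt t'P UP 1 c := by
  have hd : 0 < UP - U₀ := by linarith
  have hR : (UP * 0 - U₀ * t'P) / (UP - U₀) ≤ 2 * t'P := by
    rw [div_le_iff₀ hd]; nlinarith [mul_nonneg ht (by linarith : 0 ≤ 2 * UP - U₀)]
  have hlt : (UP * 0 - U₀ * t'P) / (UP - U₀) < κ₂ := lt_of_le_of_lt hR hκ₂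
  obtain ⟨hμ₁, hμ₂, hsum, hcomb⟩ := bracket_weights hlt hR hκ₂.le
  exact ObsStiffnessSeqCeilingAt_halfFilling_of_mottStation_fermiSeaRow_weighted hU₀ hU hμ₁ hμ₂ hsum κ₂ hcomb hX h₂ c hc

end Leaves

end Summit.Ventures.CertifiedManyBodySolver.Observables

end
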